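import Mathlib.NumberTheory.EulerProduct.Basic
import Mathlib.NumberTheory.LSeries.Convolution
import Literature.NumberTheory.GaloisRepresentations.ArtinDirichletCoefficients
import Literature.NumberTheory.LFunctions.IdealNormCount
import Literature.NumberTheory.Sieve.BatemanHorn
import Literature.NumberTheory.Sieve.PolynomialCongruencesLemmas
import Literature.NumberTheory.Sieve.PolynomialCongruencesRootDensity
import HarnessLib

/-!
# The arithmetic functions `μ(n)ρ_g(n)`, `c_K(n)` and their Dirichlet product: multiplicativity,
# prime-power values, and an `LSeriesSummable` criterion for multiplicative functions

Topic `Literature/NumberTheory/LFunctions` (next to `IdealNormCount.lean`, `IdealMoebius.lean`,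
`RieszMeanInvDedekindZeta.lean`, `DegreeOnePrimes.lean`).  Everything here is PROVED.  This file is the
elementary half of Landau's theorem for `∑ μ(n)ρ_g(n)/n` (sequel:
`PolynomialRootMoebiusRieszMean.lean`, which proves the Dirichlet-series identity
`LSeries(μρ_g)·ζ_K = LSeries(μρ_g ⋆ c_K)`, the summability of `μρ_g ⋆ c_K` at `3/4`, and the
log-Riesz asymptotic; none of those is in THIS file).

For `g ∈ ℤ[X]` let `ρ_g(n) = #{r mod n : g(r) ≡ 0 (mod n)}` (`polyRootCountMod ![g] n`) and for a
number field `K` let `c_K(n) = #{𝔞 : N𝔞 = n}` (`idealNormCount K n`).  Proved here: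

* `lseriesSummable_of_isMultiplicative_of_prime_pow_le` — a multiplicative `h : ArithmeticFunction ℂ`
  with `‖h(p^j)‖ ≤ A (j+1)^N` (`j ≥ 1`) and `∑_p ‖h(p)‖ p^{-σ} < ∞` is `LSeriesSummable` at every
  `σ > 1/2`, with a bound on `∑' ‖term h σ n‖` (majorant argument on the tree's
  `summable_norm_of_summable_norm_prime_pow` / `prod_tsum_norm_prime_pow_le_exp`);
* for the local notations `μρ[g] = (n ↦ μ(n)ρ_g(n))`, `cK[K] = (n ↦ c_K(n))` (over Mathlib's
  `toArithmeticFunction`; no new definitions) and `hE[g, K] = μρ[g] * cK[K]`: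
  `isMultiplicative_moebiusRootCount`, `isMultiplicative_idealCountFunction`,
  `isMultiplicative_rootExcess`; `moebiusRootCount_prime` (`a(p) = −ρ_g(p)`),
  `moebiusRootCount_prime_pow` (`a(p^j) = 0`, `j ≥ 2`), `rootExcess_prime_pow`,
  `rootExcess_prime` (`h(p) = c_K(p) − ρ_g(p)`), `norm_rootExcess_prime_pow_le`
  (`‖h(p^j)‖ ≤ c_K(p^j) + ρ_g(p)c_K(p^{j−1})`).

## References
* E. Landau, *Neuer Beweis des Primzahlsatzes und Beweis des Primidealsatzes*, Math. Ann. 56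
  (1903), 645–670 (context: the analytic input of the sequel). [LandauMathAnn1903]
* H. L. Montgomery, R. C. Vaughan, *Multiplicative Number Theory I*, CUP 2007, §1.3 and §6.2
  (multiplicative functions, Euler-product majorants; the case `K = ℚ`, `g = X`). [MontgomeryVaughan2007]
-/

noncomputable section

open Filter Finset Nat ArithmeticFunction Polynomial Complex
open scoped Topology BigOperators NumberField ArithmeticFunction.Moebius

namespace Literature.NumberTheory.LFunctions

open Literature.NumberTheory.Sieve Literature.NumberTheory.GaloisRepresentations

/-! ## `LSeriesSummable` of a multiplicative function from prime-power bounds -/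

/-- The comparison series `∑_e (e+3)^N q^e` converges for `0 ≤ q < 1`. [folklore] -/
theorem summable_pow_add_three_mul_geometric (N : ℕ) {q : ℝ} (hq0 : 0 ≤ q) (hq : q < 1) :
    Summable fun e : ℕ => ((e : ℝ) + 3) ^ N * q ^ e := by
  have hnorm : ‖q‖ < 1 := by rwa [Real.norm_of_nonneg hq0]
  have h := summable_pow_mul_geometric_of_norm_lt_one N hnorm
  rcases hq0.eq_or_lt with rfl | hqpos
  · refine summable_of_ne_finset_zero (s := {0}) fun e he => ?_
    rw [Finset.mem_singleton] at he
    simp [zero_pow he]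
  · have h3 : Summable fun e : ℕ => (((e + 3 : ℕ) : ℝ)) ^ N * q ^ (e + 3) :=
      (summable_nat_add_iff 3).mpr h
    have : (fun e : ℕ => ((e : ℝ) + 3) ^ N * q ^ e) =
        fun e : ℕ => (q ^ 3)⁻¹ * ((((e + 3 : ℕ) : ℝ)) ^ N * q ^ (e + 3)) := by
      funext e
      push_cast
      field_simp
      ring
    rw [this]
    exact h3.mul_left _

/-- **`LSeriesSummable` from the Euler majorant.**  Let `h : ArithmeticFunction ℂ` be
multiplicative with `‖h(p^j)‖ ≤ A (j+1)^N` for all primes `p` and `j ≥ 1`, and suppose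
`∑_p ‖h(p)‖ p^{-σ} < ∞` for some `σ > 1/2`.  Then `h` is `LSeriesSummable` at `σ` and
`∑' n, ‖term h σ n‖ ≤ exp(∑_p (‖h p‖p^{-σ} + A κ p^{-2σ}))` for an explicit `κ`
(majorant: `∑_{j ≥ 2} A(j+1)^N p^{-jσ} ≤ Aκ p^{-2σ}` is summable over `p` since `2σ > 1`). [folklore] -/
theorem lseriesSummable_of_isMultiplicative_of_prime_pow_le {h : ArithmeticFunction ℂ}
    (hmult : h.IsMultiplicative) {A : ℝ} (hA : 0 ≤ A) {N : ℕ} {σ : ℝ} (hσ : 1 / 2 < σ)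
    (hpp : ∀ p : ℕ, p.Prime → ∀ j : ℕ, 1 ≤ j → ‖h (p ^ j)‖ ≤ A * ((j : ℝ) + 1) ^ N)
    (hprimes : Summable fun p : Nat.Primes => ‖h p‖ * (p : ℝ) ^ (-σ)) :
    ∃ B : ℝ, LSeriesSummable h (σ : ℂ) ∧ ∑' n, ‖LSeries.term h σ n‖ ≤ B := by
  have hσ0 : 0 < σ := by linarith
  -- the multiplicative function `f(n) = h(n) n^{-σ}` (complex-valued)
  set f : ℕ → ℂ := fun n => h n * ((n : ℝ) ^ (-σ) : ℝ) with hf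
  have hnf : ∀ n, ‖f n‖ = ‖h n‖ * (n : ℝ) ^ (-σ) := fun n => by
    simp only [hf, norm_mul, Complex.norm_real, Real.norm_of_nonneg (Real.rpow_nonneg n.cast_nonneg _)]
  have hf1 : f 1 = 1 := by simp [hf, hmult.map_one]
  have hfmul : ∀ {m n : ℕ}, m.Coprime n → f (m * n) = f m * f n := by
    intro m n hmn
    simp only [hf]
    rw [hmult.map_mul_of_coprime hmn, Nat.cast_mul, Real.mul_rpow (by positivity) (by positivity)]
    push_cast
    ring
  -- comparison constants
  set q₀ : ℝ := (2 : ℝ) ^ (-σ) with hq₀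
  have hq₀pos : 0 < q₀ := by positivity
  have hq₀lt : q₀ < 1 := Real.rpow_lt_one_of_one_lt_of_neg (by norm_num) (by linarith)
  set κ : ℝ := ∑' e : ℕ, ((e : ℝ) + 3) ^ N * q₀ ^ e with hκ
  have hκsum := summable_pow_add_three_mul_geometric N hq₀pos.le hq₀lt
  have hκ0 : 0 ≤ κ := tsum_nonneg fun e => by positivity
  -- per-prime facts
  have hqp : ∀ {p : ℕ}, p.Prime → 0 < (p : ℝ) ^ (-σ) ∧ (p : ℝ) ^ (-σ) ≤ q₀ := by
    intro p hp
    have hp0 : (0 : ℝ) < p := by exact_mod_cast hp.pos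
    exact ⟨Real.rpow_pos_of_pos hp0 _,
      Real.rpow_le_rpow_of_nonpos (by norm_num) (by exact_mod_cast hp.two_le) (by linarith)⟩
  have hfpow : ∀ {p : ℕ}, p.Prime → ∀ j : ℕ, ‖f (p ^ j)‖ = ‖h (p ^ j)‖ * ((p : ℝ) ^ (-σ)) ^ j := by
    intro p hp j
    have hp0 : (0 : ℝ) ≤ p := by positivity
    rw [hnf]
    push_cast
    rw [← Real.rpow_natCast ((p : ℝ) ^ (-σ)) j, ← Real.rpow_mul hp0, mul_comm (-σ),
      Real.rpow_mul hp0, Real.rpow_natCast]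
  have hfle : ∀ {p : ℕ}, p.Prime → ∀ j : ℕ, 1 ≤ j →
      ‖f (p ^ j)‖ ≤ A * ((j : ℝ) + 1) ^ N * ((p : ℝ) ^ (-σ)) ^ j := by
    intro p hp j hj
    rw [hfpow hp]
    exact mul_le_mul_of_nonneg_right (hpp p hp j hj) (by positivity)
  -- summability along each prime (shift past `e = 0`, then dominate)
  have hsum1 : ∀ {p : ℕ}, p.Prime → Summable fun e : ℕ => ‖f (p ^ (e + 1))‖ := by
    intro p hp
    obtain ⟨hq1, hq2⟩ := hqp hp
    have hqlt : (p : ℝ) ^ (-σ) < 1 := lt_of_le_of_lt hq2 hq₀lt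
    have hdom : Summable fun e : ℕ => A * (((e : ℝ) + 3) ^ N * ((p : ℝ) ^ (-σ)) ^ (e + 1)) := by
      have := (summable_pow_add_three_mul_geometric N hq1.le hqlt).mul_left (A * (p : ℝ) ^ (-σ))
      refine this.congr fun e => ?_
      ring
    refine Summable.of_nonneg_of_le (fun e => norm_nonneg _) (fun e => ?_) hdom
    have hbase : ((e + 1 : ℕ) : ℝ) + 1 ≤ (e : ℝ) + 3 := by push_cast; linarith
    have hpow : (((e + 1 : ℕ) : ℝ) + 1) ^ N ≤ ((e : ℝ) + 3) ^ N :=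
      pow_le_pow_left₀ (by positivity) hbase N
    calc ‖f (p ^ (e + 1))‖ ≤ A * (((e + 1 : ℕ) : ℝ) + 1) ^ N * ((p : ℝ) ^ (-σ)) ^ (e + 1) :=
          hfle hp (e + 1) (Nat.succ_le_succ (Nat.zero_le _))
      _ ≤ A * (((e : ℝ) + 3) ^ N * ((p : ℝ) ^ (-σ)) ^ (e + 1)) := by
          rw [mul_assoc]
          exact mul_le_mul_of_nonneg_left (mul_le_mul_of_nonneg_right hpow (by positivity)) hA
  have hsum : ∀ {p : ℕ}, p.Prime → Summable fun e : ℕ => ‖f (p ^ e)‖ := fun hp =>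
    (summable_nat_add_iff 1).mp (hsum1 hp)
  -- the local excess `t_p = ‖h p‖ p^{-σ} + A κ p^{-2σ}`
  set t : Nat.Primes → ℝ := fun p => ‖h p‖ * ((p : ℕ) : ℝ) ^ (-σ) +
    A * κ * ((p : ℕ) : ℝ) ^ (-(2 * σ)) with ht
  have ht0 : ∀ p, 0 ≤ t p := fun p => by simp only [ht]; positivity
  have htsum : Summable t :=
    hprimes.add (((Nat.Primes.summable_rpow).mpr (by linarith)).mul_left (A * κ))
  have hle : ∀ p : Nat.Primes, ∑' e : ℕ, ‖f ((p : ℕ) ^ e)‖ ≤ 1 + t p := by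
    intro p
    have hp : (p : ℕ).Prime := p.prop
    obtain ⟨hq1, hq2⟩ := hqp hp
    rw [(hsum hp).tsum_eq_zero_add, pow_zero, hf1, norm_one, (hsum1 hp).tsum_eq_zero_add]
    simp only [zero_add, pow_one]
    have hs2 : Summable fun e : ℕ => ‖f ((p : ℕ) ^ (e + 1 + 1))‖ :=
      (summable_nat_add_iff 1).mpr (hsum1 hp)
    have hdom2 : ∀ e : ℕ, ‖f ((p : ℕ) ^ (e + 1 + 1))‖ ≤ A * ((p : ℕ) : ℝ) ^ (-(2 * σ)) *
        (((e : ℝ) + 3) ^ N * q₀ ^ e) := by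
      intro e
      have h1 := hfle hp (e + 2) (by omega)
      have hp0 : (0 : ℝ) ≤ (p : ℕ) := by positivity
      have hp2' : (((p : ℕ) : ℝ) ^ (-σ)) ^ 2 = ((p : ℕ) : ℝ) ^ (-(2 * σ)) := by
        rw [← Real.rpow_natCast, ← Real.rpow_mul hp0]
        congr 1
        push_cast
        ring
      have hp2 : (((p : ℕ) : ℝ) ^ (-σ)) ^ (e + 2) =
          ((p : ℕ) : ℝ) ^ (-(2 * σ)) * (((p : ℕ) : ℝ) ^ (-σ)) ^ e := by
        rw [pow_add, hp2', mul_comm]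
      have hbase : (((e + 2 : ℕ) : ℝ) + 1) ^ N ≤ ((e : ℝ) + 3) ^ N := by
        have : ((e + 2 : ℕ) : ℝ) + 1 = (e : ℝ) + 3 := by push_cast; ring
        rw [this]
      have hqe : (((p : ℕ) : ℝ) ^ (-σ)) ^ e ≤ q₀ ^ e := pow_le_pow_left₀ hq1.le hq2 e
      calc ‖f ((p : ℕ) ^ (e + 1 + 1))‖ = ‖f ((p : ℕ) ^ (e + 2))‖ := by ring_nf
        _ ≤ A * (((e + 2 : ℕ) : ℝ) + 1) ^ N * (((p : ℕ) : ℝ) ^ (-σ)) ^ (e + 2) := h1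
        _ = A * ((p : ℕ) : ℝ) ^ (-(2 * σ)) *
              ((((e + 2 : ℕ) : ℝ) + 1) ^ N * (((p : ℕ) : ℝ) ^ (-σ)) ^ e) := by rw [hp2]; ring
        _ ≤ A * ((p : ℕ) : ℝ) ^ (-(2 * σ)) * (((e : ℝ) + 3) ^ N * q₀ ^ e) := by
            refine mul_le_mul_of_nonneg_left ?_ (by positivity)
            exact mul_le_mul hbase hqe (by positivity) (by positivity)
    have hle2 : ∑' e : ℕ, ‖f ((p : ℕ) ^ (e + 1 + 1))‖ ≤ A * ((p : ℕ) : ℝ) ^ (-(2 * σ)) * κ := by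
      calc ∑' e : ℕ, ‖f ((p : ℕ) ^ (e + 1 + 1))‖
          ≤ ∑' e : ℕ, A * ((p : ℕ) : ℝ) ^ (-(2 * σ)) * (((e : ℝ) + 3) ^ N * q₀ ^ e) :=
            hs2.tsum_le_tsum hdom2 (hκsum.mul_left _)
        _ = A * ((p : ℕ) : ℝ) ^ (-(2 * σ)) * κ := by rw [tsum_mul_left]
    have hfp : ‖f (p : ℕ)‖ = ‖h p‖ * ((p : ℕ) : ℝ) ^ (-σ) := by rw [hnf]
    rw [hfp]
    simp only [ht]
    nlinarith [hle2]
  -- the majorant argument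
  have hS : Summable fun n => ‖f n‖ :=
    summable_norm_of_summable_norm_prime_pow hf1 hfmul hsum
      (fun s => prod_tsum_norm_prime_pow_le_exp ht0 htsum hle s)
  -- translate to `LSeries.term`
  have heq : ∀ n : ℕ, ‖LSeries.term h σ n‖ ≤ ‖f n‖ := by
    intro n
    rw [LSeries.norm_term_eq]
    split_ifs with hn
    · exact norm_nonneg _
    · rw [hnf, Complex.ofReal_re, Real.rpow_neg (by positivity), div_eq_mul_inv]
  have hsn : Summable fun n : ℕ => ‖LSeries.term h σ n‖ :=
    hS.of_nonneg_of_le (fun n => norm_nonneg _) heq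
  exact ⟨∑' n, ‖f n‖, hsn.of_norm, hsn.tsum_le_tsum heq hS⟩

/-! ## The arithmetic functions `a = μρ_g`, `c_K`, `h = a ⋆ c_K` -/

/-! The three arithmetic functions are written with LOCAL NOTATION over Mathlib's
`toArithmeticFunction` (no new definitions): `μρ[g] = (n ↦ μ(n)ρ_g(n))`, `cK[K] = (n ↦ c_K(n))`
(zeroed at `0`), `hE[g, K] = μρ[g] * cK[K]` (Dirichlet product).  The consumer file repeats the
same notation. -/

/-- `a = μρ_g` as a complex arithmetic function. -/
local notation "μρ[" g "]" => toArithmeticFunction (fun n : ℕ =>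
  ((ArithmeticFunction.moebius n : ℤ) : ℂ) * ((Literature.NumberTheory.Sieve.polyRootCountMod ![g] n : ℕ) : ℂ))

/-- `c_K` as a complex arithmetic function (zeroed at `0`). -/
local notation "cK[" K "]" => toArithmeticFunction (fun n : ℕ =>
  ((Literature.NumberTheory.LFunctions.idealNormCount K n : ℕ) : ℂ))

/-- `h = a ⋆ c_K`. -/
local notation "hE[" g ", " K "]" => ((μρ[g]) * (cK[K]) : ArithmeticFunction ℂ)

variable (g : ℤ[X]) (K : Type*) [Field K] [NumberField K]

/-- Unfolding lemma: `μρ[g] n = μ(n)ρ_g(n)` (also at `n = 0`, where both sides vanish). [folklore] -/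
theorem moebiusRootCount_apply (n : ℕ) :
    (μρ[g]) n = (moebius n : ℂ) * (polyRootCountMod ![g] n : ℂ) := by
  rcases eq_or_ne n 0 with rfl | hn
  · simp [toArithmeticFunction]
  · simp [toArithmeticFunction, hn]

/-- Unfolding lemma (off `0`): `cK[K] n = c_K(n)`. [folklore] -/
theorem idealCountFunction_apply {n : ℕ} (hn : n ≠ 0) :
    (cK[K]) n = (idealNormCount K n : ℂ) := by
  simp [toArithmeticFunction, hn]

/-- `ρ_g(1) = 1`. [folklore] -/
theorem polyRootCountMod_single_one : polyRootCountMod ![g] 1 = 1 := by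
  unfold polyRootCountMod
  simp

/-- `a = μρ_g` is multiplicative (`μ` and `ρ_g` are). [folklore] -/
theorem isMultiplicative_moebiusRootCount : (μρ[g]).IsMultiplicative := by
  refine ⟨?_, ?_⟩
  · simp [moebiusRootCount_apply, polyRootCountMod_single_one]
  · intro m n hmn
    simp only [moebiusRootCount_apply]
    rw [ArithmeticFunction.isMultiplicative_moebius.map_mul_of_coprime hmn,
      polyRootCountMod_mul_of_coprime g hmn]
    push_cast
    ring

/-- `c_K` is multiplicative. [folklore] -/
theorem isMultiplicative_idealCountFunction : (cK[K]).IsMultiplicative := by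
  refine ⟨?_, ?_⟩
  · simp [toArithmeticFunction, idealNormCount_one]
  · intro m n hmn
    rcases Nat.eq_zero_or_pos m with rfl | hm
    · simp [toArithmeticFunction]
    rcases Nat.eq_zero_or_pos n with rfl | hn
    · simp [toArithmeticFunction]
    rw [idealCountFunction_apply K (Nat.mul_ne_zero hm.ne' hn.ne'), idealCountFunction_apply K hm.ne',
      idealCountFunction_apply K hn.ne', idealNormCount_mul_of_coprime K hmn]
    push_cast
    ring

/-- `h = a ⋆ c_K` is multiplicative. [folklore] -/
theorem isMultiplicative_rootExcess : (hE[g, K]).IsMultiplicative :=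
  (isMultiplicative_moebiusRootCount g).mul (isMultiplicative_idealCountFunction K)

/-- `a(p) = −ρ_g(p)`. [folklore] -/
theorem moebiusRootCount_prime {p : ℕ} (hp : p.Prime) :
    μρ[g] p = -(polyRootCountMod ![g] p : ℂ) := by
  rw [moebiusRootCount_apply, ArithmeticFunction.moebius_apply_prime hp]
  push_cast
  ring

/-- `a(p^j) = 0` for `j ≥ 2`. [folklore] -/
theorem moebiusRootCount_prime_pow {p j : ℕ} (hp : p.Prime) (hj : 2 ≤ j) :
    μρ[g] (p ^ j) = 0 := by
  rw [moebiusRootCount_apply, ArithmeticFunction.moebius_apply_prime_pow hp (by omega)]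
  simp [show j ≠ 1 by omega]

/-- The convolution at a prime power: `h(p^j) = ∑_{i ≤ j} a(p^i) c_K(p^{j-i})`. [folklore] -/
theorem rootExcess_prime_pow {p : ℕ} (hp : p.Prime) (j : ℕ) :
    hE[g, K] (p ^ j) =
      ∑ i ∈ range (j + 1), μρ[g] (p ^ i) * cK[K] (p ^ (j - i)) := by
  rw [ArithmeticFunction.mul_apply,
    Nat.sum_divisorsAntidiagonal (fun x y => μρ[g] x * cK[K] y),
    Nat.sum_divisors_prime_pow hp]
  refine Finset.sum_congr rfl fun i hi => ?_
  rw [Nat.pow_div (Nat.lt_succ_iff.mp (mem_range.mp hi)) hp.pos]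

/-- `h(p) = c_K(p) − ρ_g(p)`. [folklore] -/
theorem rootExcess_prime {p : ℕ} (hp : p.Prime) :
    hE[g, K] p = (idealNormCount K p : ℂ) - (polyRootCountMod ![g] p : ℂ) := by
  have h := rootExcess_prime_pow g K hp 1
  rw [pow_one] at h
  rw [h, Finset.sum_range_succ, Finset.sum_range_one]
  simp only [pow_zero, pow_one, Nat.sub_zero, Nat.sub_self]
  rw [moebiusRootCount_prime g hp, (isMultiplicative_moebiusRootCount g).map_one,
    (isMultiplicative_idealCountFunction K).map_one, idealCountFunction_apply K hp.ne_zero]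
  ring

/-- Norm bound at prime powers: `‖h(p^j)‖ ≤ c_K(p^j) + ρ_g(p)·c_K(p^{j-1})` (`j ≥ 1`): only
`i = 0, 1` contribute to the convolution. [folklore] -/
theorem norm_rootExcess_prime_pow_le {p : ℕ} (hp : p.Prime) {j : ℕ} (hj : 1 ≤ j) :
    ‖hE[g, K] (p ^ j)‖ ≤ (idealNormCount K (p ^ j) : ℝ) +
      (polyRootCountMod ![g] p : ℝ) * (idealNormCount K (p ^ (j - 1)) : ℝ) := by
  rw [rootExcess_prime_pow g K hp j]
  have hsplit : ∑ i ∈ range (j + 1), μρ[g] (p ^ i) * cK[K] (p ^ (j - i)) =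
      μρ[g] (p ^ 0) * cK[K] (p ^ (j - 0)) +
        μρ[g] (p ^ 1) * cK[K] (p ^ (j - 1)) := by
    have hj2 : range (j + 1) = {0, 1} ∪ (range (j + 1)).filter (fun i => 2 ≤ i) := by
      ext i; simp only [mem_range, mem_union, mem_insert, mem_singleton, mem_filter]; omega
    rw [hj2, Finset.sum_union (by
      rw [Finset.disjoint_left]; intro i hi hi'
      simp only [mem_insert, mem_singleton] at hi
      have := (mem_filter.mp hi').2; omega)]
    rw [Finset.sum_pair (by norm_num), Finset.sum_eq_zero (fun i hi => by
      rw [moebiusRootCount_prime_pow g hp (mem_filter.mp hi).2, zero_mul]), add_zero]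
  rw [hsplit, pow_zero, Nat.sub_zero, pow_one, (isMultiplicative_moebiusRootCount g).map_one,
    one_mul, moebiusRootCount_prime g hp, idealCountFunction_apply K (pow_ne_zero _ hp.ne_zero),
    idealCountFunction_apply K (pow_ne_zero _ hp.ne_zero)]
  refine (norm_add_le _ _).trans ?_
  rw [Complex.norm_natCast, norm_mul, norm_neg, Complex.norm_natCast, Complex.norm_natCast]

end Literature.NumberTheory.LFunctions
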